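import Mathlib
import Summits.Ventures.HodgeRepro2.T5PontryaginStep

/-!
# T5AuxiliaryModulus — §F.2 («an auxiliary modulus») as ONE statement modulo its two printed inputs
(Tier-5 §G/N4.2 support)

Kernel capstone of the three-step argument of route/T5-route-3.md §F.2 (l. 83, on the record):
Dirichlet (this seat's `T5NormOneUnitsFG`: `Γ = E¹ ∩ O_E^×` is finitely generated) / Chevalley
(`T5ChevalleyReduction`) / Pontryagin (`T5PontryaginStep`), with the descent criterion of
`T5SubgroupDescent`.  Abstract setting (`G = E¹(𝔸)`, `Δ = E¹`, `H₀ = ∏_{v∈T} E¹_v × ∏_{v∉T} E¹(O_v)`,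
`H i = H_𝔪` for the modulus `i = 𝔪`, `P i` = «`𝔪` prime to `T`», `Ψ = ψ_T ⊗ 1` on `H₀`, `Q = ℂˣ`):

* `G` a commutative topological group, `Δ ≤ G` any subgroup, `H₀ ≤ G` an open subgroup carrying a
  continuous character `Ψ : H₀ →* Q` of exponent `n`, and open subgroups `H i ≤ H₀`;
* PRINTED INPUT 1 (Chevalley's theorem on units, `n`-th-power form): for every `n ≥ 1` some admissible
  `H i` has `Δ ⊓ H i` consisting of `n`-th powers of elements of `Γ := Δ ⊓ H₀`;
* PRINTED INPUT 2 (the compactness of `E¹(𝔸)/E¹`): `CompactSpace (G ⧸ Δ)`.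

Conclusion (`exists_admissible_continuous_quotient_character`): there is an admissible `i` and a
continuous character `Ψ'` of `G ⧸ Δ` of exponent `[G : Δ ⊔ H i] · n` — hence of finite order — with
`Ψ' (h : G) = Ψ h` for every `h ∈ H i` (the components `ψ_v` at `v ∈ T` are those of `Ψ`), trivial on
the image of every `U ≤ H i` on which `Ψ` is trivial («unramified outside `T ∪ supp(𝔪)`»).
The two printed inputs stay prose, as do the adelic identifications.
-/

namespace Summit.Ventures.HodgeRepro2.T5AuxiliaryModulus

open Summit.Ventures.HodgeRepro2

variable {G : Type*} [CommGroup G] [TopologicalSpace G] [IsTopologicalGroup G]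
variable {Q : Type*} [CommGroup Q] [TopologicalSpace Q] [ContinuousMul Q]

omit [TopologicalSpace G] [IsTopologicalGroup G] [TopologicalSpace Q] [ContinuousMul Q] in
/-- **The Chevalley step in the adelic shape**: if `Ψ : H₀ →* Q` has exponent `n` and `Δ ⊓ H`
consists of `n`-th powers of elements of `Δ ⊓ H₀`, then `Ψ` is trivial on `Δ ⊓ H` — the descent
criterion of `T5SubgroupDescent.exists_descend_iff` for the restriction of `Ψ` to `H`
(`T5ChevalleyReduction` supplies `hpow` from the printed `n`-th-power theorem). -/
theorem eq_one_of_mem_inf (Δ H₀ H : Subgroup G) (Ψ : H₀ →* Q) (n : ℕ) (hΨ : ∀ h, Ψ h ^ n = 1)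
    (hpow : ∀ u ∈ Δ ⊓ H, ∃ g ∈ Δ ⊓ H₀, g ^ n = u) (x : H₀) (hx : (x : G) ∈ Δ ⊓ H) : Ψ x = 1 := by
  obtain ⟨g, hg, hgx⟩ := hpow x hx
  have e : x = ⟨g, hg.2⟩ ^ n := by
    ext
    simp [hgx]
  rw [e, map_pow]
  exact hΨ _

/-- **§F.2 as one statement.** Under the two printed inputs — Chevalley's theorem (`hChev`) and the
compactness of `G ⧸ Δ` — an admissible modulus `i` exists together with a continuous character
`Ψ'` of `G ⧸ Δ` of exponent `[G : Δ ⊔ H i] · n`, extending `Ψ` on `H i` and trivial on the image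
of every `U ≤ H i` on which `Ψ` is trivial. -/
theorem exists_admissible_continuous_quotient_character [RootableBy Q ℤ] {ι : Type*}
    (Δ H₀ : Subgroup G) [CompactSpace (G ⧸ Δ)] (Ψ : H₀ →* Q) (hΨc : Continuous Ψ)
    (n : ℕ) (hΨ : ∀ h, Ψ h ^ n = 1) (H : ι → Subgroup G) (hle : ∀ i, H i ≤ H₀)
    (hopen : ∀ i, IsOpen (H i : Set G)) (P : ι → Prop)
    (hChev : ∀ m : ℕ, 0 < m → ∃ i, P i ∧ ∀ u ∈ Δ ⊓ H i, ∃ g ∈ Δ ⊓ H₀, g ^ m = u) (hn : 0 < n) :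
    ∃ i, P i ∧ ∃ Ψ' : G ⧸ Δ →* Q, Continuous Ψ' ∧
      (∀ h : H i, Ψ' (h : G) = Ψ ⟨h, hle i h.2⟩) ∧
      (∀ x : G ⧸ Δ, Ψ' x ^ ((Δ ⊔ H i).index * n) = 1) ∧
      ∀ U : Subgroup G, U ≤ H i → (∀ u : H₀, (u : G) ∈ U → Ψ u = 1) →
        ∀ u ∈ U, Ψ' (u : G) = 1 := by
  obtain ⟨i, hi, hpow⟩ := hChev n hn
  -- the restriction of `Ψ` to the open subgroup `H i`
  let ψ : H i →* Q := Ψ.comp (Subgroup.inclusion (hle i))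
  have hψc : Continuous ψ := hΨc.comp (continuous_subtype_val.subtype_mk _)
  have hψΔ : ∀ x : H i, (x : G) ∈ Δ → ψ x = 1 := fun x hx =>
    eq_one_of_mem_inf Δ H₀ (H i) Ψ n hΨ hpow (Subgroup.inclusion (hle i) x) ⟨hx, x.2⟩
  have hψn : ∀ h : H i, ψ h ^ n = 1 := fun h => hΨ _
  obtain ⟨Ψ', hc, h1, hpow', hU⟩ :=
    T5PontryaginStep.exists_continuous_quotient_character_pow_eq_one Δ (H i) (hopen i) ψ hψc hψΔ
      n hψn
  refine ⟨i, hi, Ψ', hc, fun h => h1 h, hpow', ?_⟩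
  intro U hUH hU' u hu
  exact hU U hUH (fun v hv => hU' _ hv) u hu

end Summit.Ventures.HodgeRepro2.T5AuxiliaryModulus
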